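import Mathlib.Analysis.InnerProductSpace.PiL2
import Mathlib.Analysis.Complex.Basic
import Mathlib.Geometry.Manifold.ChartedSpace
import Mathlib.Tactic

/-!
# The sphere at infinity `V∞` of the wedge cap is compact and closed
(registered helper `helper_wedgeSphereVClosed` of line `cross-cap-laurent`, crux
`GromovRecognitionRelEnd`, item stmt-SmoothPoincare4-11009)

In the wedge cap `X` (Hausdorff) the chart `ηV : ℝ⁴ → X` is continuous on the open polydisc
`D_V = {|(p 0, p 1)| < R₁⁻¹}`, which contains the whole slice `{0} × ℂ`, and the corner chart
`ηC : ℝ⁴ → X` is continuous on the bidisc `D_C = {|(p 0, p 1)| < R₁⁻¹, |(p 2, p 3)| < R₁⁻¹} ∋ 0`;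
the two are glued by complex inversion of the second factor, `ηC (t, w) = ηV (t, 1/w)` for `w ≠ 0`.
The sphere at infinity is `V∞ = ηV ({0} × ℂ) ∪ {ηC 0}`.

We prove that `V∞` is compact, hence closed.  Proof: with `r = R₁ + 1 > R₁` (so `r⁻¹ < R₁⁻¹`),
`V∞ = ηV (0 × (closed ball of radius r)) ∪ ηC (0 × (closed ball of radius r⁻¹))`: a point
`ηV (0, z)` with `‖z‖ > r` is `ηC (0, 1/z)` by the gluing clause, and `ηC (0, 0) = ηC 0`; conversely
`ηC (0, w) = ηV (0, 1/w)` for `0 < ‖w‖ ≤ r⁻¹`.  Both pieces are continuous images of compact balls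
(the slices lie in `D_V`, resp. `D_C`), so `V∞` is compact, and closed since `X` is Hausdorff.

Everything is proved from Mathlib topology; no definition, no named fact.
-/

-- the registered namespace `Summit.SmoothPoincare4.SmoothPoincare4.Theorems…` repeats a component
set_option linter.dupNamespace false

open Set Metric

namespace Summit.SmoothPoincare4.SmoothPoincare4.Theorems.GromovRecognitionRelEnd.CrossCapLaurent

/-- **The sphere at infinity `V∞` of the wedge cap is compact and closed.**  For a Hausdorff space
`X`, a chart `ηV` continuous on the polydisc `{p 0 ^ 2 + p 1 ^ 2 < R₁⁻¹ ^ 2}`, a corner chart `ηC`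
continuous on the bidisc `{p 0 ^ 2 + p 1 ^ 2 < R₁⁻¹ ^ 2, p 2 ^ 2 + p 3 ^ 2 < R₁⁻¹ ^ 2}` and the
gluing clause `ηC p = ηV (p 0, p 1, complex inverse of (p 2, p 3))` off the axis `p 2 = p 3 = 0`,
the set `ηV ({0} × ℂ) ∪ {ηC 0}` is compact and closed: it is the union of the continuous images of
the compact slices `{0} × closedBall 0 (R₁ + 1)` under `ηV` and `{0} × closedBall 0 (R₁ + 1)⁻¹`
under `ηC`. -/
theorem helper_wedgeSphereVClosed : ∀ (X : Type) [TopologicalSpace X] [T2Space X] [ChartedSpace (EuclideanSpace ℝ (Fin 4)) X] (R₁ : ℝ) (ηV ηC : EuclideanSpace ℝ (Fin 4) → X), 0 < R₁ → ContinuousOn ηV {p : EuclideanSpace ℝ (Fin 4) | p 0 ^ 2 + p 1 ^ 2 < R₁⁻¹ ^ 2} → ContinuousOn ηC {p : EuclideanSpace ℝ (Fin 4) | p 0 ^ 2 + p 1 ^ 2 < R₁⁻¹ ^ 2 ∧ p 2 ^ 2 + p 3 ^ 2 < R₁⁻¹ ^ 2} → (∀ p : EuclideanSpace ℝ (Fin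 4), p 0 ^ 2 + p 1 ^ 2 < R₁⁻¹ ^ 2 → p 2 ^ 2 + p 3 ^ 2 < R₁⁻¹ ^ 2 → (p 2 ≠ 0 ∨ p 3 ≠ 0) → ηC p = ηV (WithLp.toLp 2 ![p 0, p 1, p 2 / (p 2 ^ 2 + p 3 ^ 2), -(p 3) / (p 2 ^ 2 + p 3 ^ 2)])) → IsCompact (Set.range (fun z : ℂ => ηV (WithLp.toLp 2 ![0, 0, z.re, z.im])) ∪ {ηC 0}) ∧ IsClosed (Set.range (fun z : ℂ => ηV (WithLp.toLp 2 ![0, 0, z.re, z.im])) ∪ {ηC 0}) := by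
  intro X _ _ _ R₁ ηV ηC hR₁ hV hC hglue
  -- the slice `e z = (0, z)` of the second complex factor
  set e : ℂ → EuclideanSpace ℝ (Fin 4) := fun z => WithLp.toLp 2 ![0, 0, z.re, z.im] with he_def
  have he : Continuous e := by
    refine (PiLp.continuous_toLp 2 _).comp (continuous_pi fun i => ?_)
    fin_cases i
    · exact continuous_const
    · exact continuous_const
    · exact Complex.continuous_re
    · exact Complex.continuous_im
  have he0 : ∀ z : ℂ, e z 0 = 0 := fun z => by simp [he_def]
  have he1 : ∀ z : ℂ, e z 1 = 0 := fun z => by simp [he_def]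
  have he2 : ∀ z : ℂ, e z 2 = z.re := fun z => by simp [he_def]
  have he3 : ∀ z : ℂ, e z 3 = z.im := fun z => by simp [he_def]
  have he_zero : e 0 = 0 := by
    ext i
    fin_cases i <;> simp [he_def]
  -- radii: `r = R₁ + 1 > R₁`, so `r⁻¹ < R₁⁻¹`
  have hR : (0 : ℝ) < R₁⁻¹ ^ 2 := pow_pos (inv_pos.mpr hR₁) 2
  set r : ℝ := R₁ + 1 with hr_def
  have hr : 0 < r := by linarith
  have hrR : r⁻¹ < R₁⁻¹ := inv_strictAnti₀ hR₁ (by linarith)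
  have hrR2 : r⁻¹ ^ 2 < R₁⁻¹ ^ 2 := pow_lt_pow_left₀ hrR (inv_pos.mpr hr).le two_ne_zero
  -- the slice lies in the two polydiscs
  have hnorm : ∀ w : ℂ, e w 2 ^ 2 + e w 3 ^ 2 = ‖w‖ ^ 2 := fun w => by
    rw [he2, he3, ← Complex.normSq_eq_norm_sq, Complex.normSq_apply]
    ring
  have hsmall : ∀ w : ℂ, ‖w‖ ≤ r⁻¹ → e w 2 ^ 2 + e w 3 ^ 2 < R₁⁻¹ ^ 2 := fun w hw => by
    rw [hnorm]
    calc ‖w‖ ^ 2 ≤ r⁻¹ ^ 2 := by gcongr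
      _ < R₁⁻¹ ^ 2 := hrR2
  have hfst : ∀ w : ℂ, e w 0 ^ 2 + e w 1 ^ 2 < R₁⁻¹ ^ 2 := fun w => by
    have h0 : (0 : ℝ) ^ 2 + 0 ^ 2 = 0 := by norm_num
    rw [he0, he1, h0]
    exact hR
  -- the gluing clause on the slice: `ηC (0, w) = ηV (0, 1/w)` for `0 < ‖w‖ ≤ r⁻¹`
  have hglue' : ∀ w : ℂ, w ≠ 0 → ‖w‖ ≤ r⁻¹ → ηC (e w) = ηV (e w⁻¹) := by
    intro w hw hwr
    have hne : e w 2 ≠ 0 ∨ e w 3 ≠ 0 := by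
      rw [he2, he3]
      by_contra h
      push Not at h
      exact hw (Complex.ext (by simpa using h.1) (by simpa using h.2))
    have hsq : w.re ^ 2 + w.im ^ 2 = Complex.normSq w := by
      rw [Complex.normSq_apply]
      ring
    have hinv : e w⁻¹ = WithLp.toLp 2
        ![e w 0, e w 1, e w 2 / (e w 2 ^ 2 + e w 3 ^ 2), -(e w 3) / (e w 2 ^ 2 + e w 3 ^ 2)] := by
      rw [he0, he1, he2, he3, hsq]
      change WithLp.toLp 2 ![0, 0, (w⁻¹).re, (w⁻¹).im] = _
      rw [Complex.inv_re, Complex.inv_im]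
    rw [hinv]
    exact hglue (e w) (hfst w) (hsmall w hwr) hne
  -- the two compact pieces
  have hK₁ : IsCompact ((ηV ∘ e) '' closedBall (0 : ℂ) r) :=
    (isCompact_closedBall (0 : ℂ) r).image_of_continuousOn
      (hV.comp he.continuousOn fun z _ => hfst z)
  have hK₂ : IsCompact ((ηC ∘ e) '' closedBall (0 : ℂ) r⁻¹) :=
    (isCompact_closedBall (0 : ℂ) r⁻¹).image_of_continuousOn
      (hC.comp he.continuousOn fun w hw => ⟨hfst w, hsmall w (mem_closedBall_zero_iff.mp hw)⟩)
  -- `V∞` is their union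
  have hEq : Set.range (fun z : ℂ => ηV (WithLp.toLp 2 ![0, 0, z.re, z.im])) ∪ {ηC 0} =
      (ηV ∘ e) '' closedBall (0 : ℂ) r ∪ (ηC ∘ e) '' closedBall (0 : ℂ) r⁻¹ := by
    apply Set.Subset.antisymm
    · rintro y (⟨z, rfl⟩ | rfl)
      · change ηV (e z) ∈ _
        by_cases hz : ‖z‖ ≤ r
        · exact Or.inl ⟨z, mem_closedBall_zero_iff.mpr hz, rfl⟩
        · push Not at hz
          have hz0 : z ≠ 0 := norm_pos_iff.mp (hr.trans hz)
          have hzr : ‖z⁻¹‖ ≤ r⁻¹ := by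
            rw [norm_inv]
            exact inv_anti₀ hr hz.le
          refine Or.inr ⟨z⁻¹, mem_closedBall_zero_iff.mpr hzr, ?_⟩
          change ηC (e z⁻¹) = ηV (e z)
          rw [hglue' z⁻¹ (inv_ne_zero hz0) hzr, inv_inv]
      · refine Or.inr ⟨0, mem_closedBall_self (inv_pos.mpr hr).le, ?_⟩
        change ηC (e 0) = ηC 0
        rw [he_zero]
    · rintro y (⟨z, -, rfl⟩ | ⟨w, hw, rfl⟩)
      · exact Or.inl ⟨z, rfl⟩
      · by_cases hw0 : w = 0
        · subst hw0
          right
          change ηC (e 0) ∈ ({ηC 0} : Set X)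
          rw [he_zero]
          exact Set.mem_singleton _
        · left
          refine ⟨w⁻¹, ?_⟩
          change ηV (e w⁻¹) = ηC (e w)
          exact (hglue' w hw0 (mem_closedBall_zero_iff.mp hw)).symm
  have hK : IsCompact (Set.range (fun z : ℂ => ηV (WithLp.toLp 2 ![0, 0, z.re, z.im])) ∪ {ηC 0}) := by
    rw [hEq]
    exact hK₁.union hK₂
  exact ⟨hK, hK.isClosed⟩

end Summit.SmoothPoincare4.SmoothPoincare4.Theorems.GromovRecognitionRelEnd.CrossCapLaurent
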